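import Mathlib.RepresentationTheory.Homological.GroupCohomology.Functoriality
import Literature.AlgebraicGeometry.HodgeTheory.LocallyTrivialExtensionClasses

/-!
# Route LinearSystemTorelli — crux `LocalTubeSpan` (stmt-HodgeConjecture-2490): detection ascends along coordinates

Helper file (`--supports stmt-HodgeConjecture-2490`, line `Sketch` of the crux chain, cycle 4
"portability of cyclic detection", stub `stub_coordinatesUp`).  The line's injectivity theorems
for Schnell's third map `evalCoinv A : H¹(G, A) → ∏_g A/(g - 1)A` ("cyclic detection": a
`1`-cocycle with `φ g ∈ (g - 1)A` for every `g` is a coboundary) are over `ℚ`, while the tree's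
hyperplane-section local systems live over `ℂ` with a fibrewise `ℚ`-structure; so detection must
be PORTABLE along an extension of scalars `k → K`.  This file is the hard direction — detection
ASCENDS — stated abstractly, with no tensor products:

* `localTubeSpan_injective_evalCoinv_of_coordinates` — let `i : A → A'` be an additive `G`-map
  (`A` over `k`, `A'` over `K`) and let `π_j : A' → A` (`j ∈ J`) be additive `G`-equivariant
  "coordinates" with scalars `b_j ∈ K`: every `x'` has finitely many non-zero coordinates and
  `x' = Σ_{j ∈ T} b_j • i (π_j x')` for every finite `T` outside which the coordinates of `x'`
  vanish (think `A' = K ⊗_k A`, `b` a `k`-basis of `K`, `π_j = b_j^* ⊗ id`).  Suppose the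
  invariants of `A` are witnessed by a finite set `F ⊆ G` (`F`-fixed ⇒ `G`-fixed; automatic for
  finite-dimensional `A`).  Then injectivity of Schnell's third map for `A` implies it for `A'`.

Proof.  An undetected cocycle `φ'` of `A'` has undetected coordinate cocycles
`φ_j = π_j ∘ φ'` of `A`, each a coboundary `d x_j` by hypothesis.  For `j` outside the finite set
`J₀ = ⋃_{g ∈ F} supp π_•(φ' g)` the cocycle `φ_j` vanishes on `F`, so `x_j` is `F`-fixed, hence
`G`-fixed, hence `φ_j = 0` identically; therefore every `φ' g` is carried by `J₀`,
`φ' g = Σ_{j ∈ J₀} b_j • i (g x_j - x_j) = g x' - x'` for `x' = Σ_{j ∈ J₀} b_j • i x_j`, and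
`φ' = d x'`.  (The finiteness used is that of the invariants of `A`, NOT finite generation of
`G`.)  Pure group cohomology over Mathlib (`groupCohomology.H1`) and the tree's vocabulary
(`Literature.AlgebraicGeometry.HodgeTheory.LocallyTrivialExtensionClasses`: `evalCoinv`,
`subOneRange`); no named facts.  Reference for the setting: C. Schnell, *Primitive cohomology and
the tube mapping*, Math. Z. 268 (2010) §3 (the third map), §7.
-/

-- `Summit.HodgeConjecture.HodgeConjecture.Theorems` is the mandated namespace (single-conjunct summit:
-- Sub = Summit), which `linter.dupNamespace` flags on every declaration; the lakefile turns the
-- linter off tree-wide (weak option), restated here so stand-alone elaboration is warning-free too.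
set_option linter.dupNamespace false

noncomputable section

open CategoryTheory groupCohomology
open Literature.AlgebraicGeometry.HodgeTheory

namespace Summit.HodgeConjecture.HodgeConjecture.Theorems

universe u v

/-- The coordinates of a `1`-cocycle along additive `G`-equivariant maps `π_j : A' → A` are
`1`-cocycles: `π_j ∘ φ' ∈ Z¹(G, A)`. [folklore] -/
theorem localTubeSpan_coordinate_mem_cocycles₁ {k K G : Type u} [Group G] [CommRing k]
    [CommRing K] (A : Rep k G) (A' : Rep K G) (π : A'.V →+ A.V)
    (hπ : ∀ (g : G) (x' : A'.V), π (A'.ρ g x') = A.ρ g (π x')) (φ' : cocycles₁ A') :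
    (fun g : G => π ((φ' : G → A'.V) g)) ∈ cocycles₁ A := by
  rw [mem_cocycles₁_iff]
  intro g h
  rw [(mem_cocycles₁_iff φ').1 φ'.2 g h, map_add, hπ]

/-- An undetected `1`-cocycle `φ'` of `A'` (`φ' g ∈ (g - 1)A'` for all `g`) has undetected
coordinates: if Schnell's third map of `A` is injective then every coordinate cocycle
`π ∘ φ'` along an additive `G`-equivariant `π : A' → A` is a coboundary. [folklore] -/
theorem localTubeSpan_exists_primitive_coordinate_of_undetected {k K G : Type u} [Group G]
    [CommRing k] [CommRing K] (A : Rep k G) (A' : Rep K G) (π : A'.V →+ A.V)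
    (hπ : ∀ (g : G) (x' : A'.V), π (A'.ρ g x') = A.ρ g (π x'))
    (hinj : Function.Injective (evalCoinv A)) (φ' : cocycles₁ A')
    (hφ' : ∀ g : G, (φ' : G → A'.V) g ∈ subOneRange A' g) :
    ∃ x : A.V, ∀ g : G, A.ρ g x - x = π ((φ' : G → A'.V) g) := by
  set ψ : cocycles₁ A := ⟨_, localTubeSpan_coordinate_mem_cocycles₁ A A' π hπ φ'⟩
  have hψ0 : evalCoinv A (H1π A ψ) = 0 := by
    funext g
    rw [evalCoinv_H1π, Pi.zero_apply, Submodule.mkQ_apply, Submodule.Quotient.mk_eq_zero]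
    obtain ⟨y, hy⟩ := hφ' g
    refine ⟨π y, ?_⟩
    rw [LinearMap.sub_apply, LinearMap.id_apply] at hy ⊢
    change A.ρ g (π y) - π y = π ((φ' : G → A'.V) g)
    rw [← hy, map_sub, hπ]
  have hzero : H1π A ψ = 0 := (injective_iff_map_eq_zero _).1 hinj _ hψ0
  rw [H1π_eq_zero_iff, mem_coboundaries₁_iff_exists] at hzero
  exact hzero

/-- **Detection ascends along equivariant coordinates** (cycle 4, portability of cyclic detection
under extension of scalars — the hard direction).  Let `i : A → A'` be an additive `G`-map (`A` a
`k`-representation, `A'` a `K`-representation of `G`) and `π_j : A' → A` (`j ∈ J`) additive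
`G`-equivariant coordinates with scalars `b_j ∈ K`: every vector has finitely many non-zero
coordinates and `x' = Σ_{j ∈ T} b_j • i (π_j x')` for every finite `T` outside which the
coordinates of `x'` vanish (e.g. `A' = K ⊗_k A`, `b` a `k`-basis of `K`, `π_j = b_j^* ⊗ id`).
If the invariants of `A` are witnessed by a finite `F ⊆ G` (`F`-fixed vectors are `G`-fixed) and
Schnell's third map `H¹(G, A) → ∏_g A/(g - 1)A` is injective, then so is
`H¹(G, A') → ∏_g A'/(g - 1)A'`: an undetected `φ'` has undetected coordinates `π_j ∘ φ' = d x_j`;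
off the finite set `J₀ = ⋃_{g ∈ F} supp π_•(φ' g)` the vector `x_j` is `F`-fixed, hence
`G`-fixed, so `π_j ∘ φ' = 0`; hence `φ' = d (Σ_{j ∈ J₀} b_j • i x_j)`. [folklore] -/
theorem localTubeSpan_injective_evalCoinv_of_coordinates {k K G : Type u} [Group G] [CommRing k]
    [CommRing K] (A : Rep k G) (A' : Rep K G)
    (i : A.V →+ A'.V) (hi : ∀ (g : G) (x : A.V), i (A.ρ g x) = A'.ρ g (i x))
    {J : Type v} (b : J → K) (π : J → (A'.V →+ A.V))
    (hπ : ∀ (j : J) (g : G) (x' : A'.V), π j (A'.ρ g x') = A.ρ g (π j x'))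
    (hfin : ∀ x' : A'.V, (Function.support fun j => π j x').Finite)
    (hrec : ∀ (x' : A'.V) (T : Finset J), (∀ j ∉ T, π j x' = 0) →
      x' = ∑ j ∈ T, b j • i (π j x'))
    (F : Finset G) (hF : ∀ x : A.V, (∀ g ∈ F, A.ρ g x = x) → ∀ g : G, A.ρ g x = x)
    (hinj : Function.Injective (evalCoinv A)) :
    Function.Injective (evalCoinv A') := by
  classical
  refine (injective_iff_map_eq_zero _).2 fun ξ hξ => ?_
  induction ξ using H1_induction_on with
  | h φ' =>
    -- `φ'` is undetected: all its values lie in `(g - 1)A'`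
    have hφ' : ∀ g : G, (φ' : G → A'.V) g ∈ subOneRange A' g := fun g => by
      have := congr_fun hξ g
      rwa [evalCoinv_H1π, Pi.zero_apply, Submodule.mkQ_apply, Submodule.Quotient.mk_eq_zero]
        at this
    -- primitives of the (undetected) coordinate cocycles `π_j ∘ φ'`
    have hprim : ∀ j : J, ∃ x : A.V, ∀ g : G, A.ρ g x - x = π j ((φ' : G → A'.V) g) :=
      fun j => localTubeSpan_exists_primitive_coordinate_of_undetected A A' (π j) (hπ j) hinj
        φ' hφ'
    choose x hx using hprim
    -- the finite set of coordinates seen by the witnessing set `F`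
    set J₀ : Finset J := F.biUnion fun g => (hfin ((φ' : G → A'.V) g)).toFinset
    have hout : ∀ j ∉ J₀, ∀ g ∈ F, π j ((φ' : G → A'.V) g) = 0 := fun j hj g hg => by
      by_contra hne
      exact hj (Finset.mem_biUnion.2 ⟨g, hg, (Set.Finite.mem_toFinset _).2 hne⟩)
    -- off `J₀` the primitive is `F`-fixed, hence `G`-fixed, hence the coordinate cocycle is `0`
    have hπout : ∀ j ∉ J₀, ∀ g : G, π j ((φ' : G → A'.V) g) = 0 := fun j hj => by
      have hfix : ∀ g : G, A.ρ g (x j) = x j := hF (x j) fun g hg => by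
        have := hx j g
        rwa [hout j hj g hg, sub_eq_zero] at this
      intro g
      rw [← hx j g, hfix g, sub_self]
    -- `φ' = d x'` for `x' = Σ_{j ∈ J₀} b_j • i x_j`
    rw [H1π_eq_zero_iff, mem_coboundaries₁_iff_exists]
    refine ⟨∑ j ∈ J₀, b j • i (x j), fun g => ?_⟩
    rw [hrec ((φ' : G → A'.V) g) J₀ (fun j hj => hπout j hj g), map_sum,
      ← Finset.sum_sub_distrib]
    refine Finset.sum_congr rfl fun j _ => ?_
    rw [← hx j g, map_sub i, smul_sub, hi, map_smul]

end Summit.HodgeConjecture.HodgeConjecture.Theorems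

end
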